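import Literature.AlgebraicGeometry.Resolution.OneDimAnalyticallyUnramifiedFinite
import Literature.AlgebraicGeometry.Resolution.SmoothFactorizationsFractionRing
import Literature.AlgebraicGeometry.Resolution.RegularHomReduced
import Mathlib.RingTheory.AdicCompletion.Noetherian
import Mathlib.RingTheory.Ideal.Height
import HarnessLib

/-!
# Analytically unramified one-dimensional REDUCED local rings have finite normalization
# (Krull 1930; Kollár 2007, Thm. 1.101, (3) ⇒ (2), the non-domain case)

Topic: `Literature/AlgebraicGeometry/Resolution`. Kollár, *Lectures on Resolution of
Singularities* (2007), Thm. 1.101 [Kru30, Satz 7]: for a one-dimensional semi-local ring `S`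
without embedded points, (1) the blow-up sequence stabilizes at regular rings ⇔ (2) `S` is
reduced with finite normalization ⇔ (3) `Ŝ` is reduced. The tree proves (3) ⇒ (2) for local
DOMAINS (`module_finite_integralClosure_of_isReduced_adicCompletion`,
`OneDimAnalyticallyUnramifiedFinite.lean`). This file PROVES (3) ⇒ (2) for an arbitrary
one-dimensional Noetherian LOCAL ring `R` (no domain hypothesis), on Mathlib's total ring of
fractions `FractionRing R = Localization R⁰ R` and `integralClosure R (FractionRing R)`:

* (tree, `RegularHomReduced.lean`) `isReduced_of_isReduced_adicCompletion` — `R ⊆ R̂` (Krull's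
  intersection theorem), so `R` is reduced;
* `exists_mem_maximalIdeal_mem_nonZeroDivisors` — a reduced local ring of dimension `1` has a
  non-zero-divisor in `𝔪` (the zero divisors are the union of the finitely many minimal primes,
  Stacks 00EW, and `𝔪` is not minimal);
* `module_finite_integralClosure_of_isReduced_adicCompletion'` — **(3) ⇒ (2)**: if `R̂` is
  reduced then the integral closure `R̄` of `R` in its total ring of fractions is a finite
  `R`-module. The proof is the conductor descent of the domain case verbatim, with "nonzero"
  replaced by "non-zero-divisor": for `x ∈ 𝔪 ∩ R⁰` and each minimal prime `𝔓` of `S = R̂`, the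
  complete local domain `S/𝔓` has finite normalization (Kollár Thm. 1.102, the tree's
  `exists_pow_mul_mem_range_of_complete`), whence `x^N a ∈ sS + 𝔓` whenever `a/s ∈ R̄`
  (`s ∈ R⁰` is `S`-regular by flatness, so lies in no minimal prime of `S`); patching over the
  minimal primes of the reduced ring `S` (`exists_notMem_minimalPrimes_forall_mul_mem`,
  `exists_pow_mem_span_of_notMem_minimalPrimes`) and faithful flatness give `x^{M+N} R̄ ⊆ R`,
  and `x^{M+N}` is a unit of the total ring of fractions, so `R̄ ≅ x^{M+N} R̄ ⊆ R·1` is finitely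
  generated.

No definitions, no named facts. This is the input "finiteness of normalisation from reduced
completion" of the named fact `Kollar2007_thm_1_101_localChain` (`OneDimensionalBlowupTower.lean`)
for reduced non-domain local rings of curves.

## Sources

* J. Kollár, *Lectures on Resolution of Singularities*, Ann. of Math. Stud. 166 (2007), §1.13,
  Thm. 1.101 and Thm. 1.102 (PDF pp. 58–59 of the held copy). [Kollar2007]
* The Stacks Project, Tag 00EW (zero divisors of a reduced ring). [StacksProject]
-/

noncomputable section

open IsLocalRing Polynomial nonZeroDivisors

namespace Literature.AlgebraicGeometry.Resolution

universe u

section Reduced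

variable (R : Type u) [CommRing R] [IsNoetherianRing R] [IsLocalRing R]

/-- In a reduced Noetherian local ring of dimension one the maximal ideal contains a
non-zero-divisor: otherwise `𝔪` consists of zero divisors, hence is a minimal prime
(Stacks 00EW and prime avoidance), i.e. has height `0 = dim R`. [cite: StacksProject, Tag 00EW] -/
theorem exists_mem_maximalIdeal_mem_nonZeroDivisors [IsReduced R] (hdim : ringKrullDim R = 1) :
    ∃ x ∈ maximalIdeal R, x ∈ R⁰ := by
  by_contra! h
  have hd : Disjoint ((R⁰ : Submonoid R) : Set R) (maximalIdeal R : Set R) :=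
    Set.disjoint_left.mpr fun x hx hxm => h x hxm hx
  have hmin : maximalIdeal R ∈ minimalPrimes R :=
    mem_minimalPrimes_of_disjoint_nonZeroDivisors (maximalIdeal R) hd
  have h0 : (maximalIdeal R).height = 0 := Ideal.height_eq_zero_iff.mpr hmin
  have h1 : ringKrullDim R = 0 := by
    rw [← IsLocalRing.maximalIdeal_height_eq_ringKrullDim, h0]; rfl
  rw [hdim] at h1
  exact one_ne_zero h1

/-- **Kollár Thm. 1.101, (3) ⇒ (2), for one-dimensional Noetherian local rings** (no domain
hypothesis): if the `𝔪`-adic completion `R̂` is reduced, then the integral closure `R̄` of `R`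
in its total ring of fractions (any `K` with `IsFractionRing R K`) is a finite `R`-module.
Conductor descent: for a
non-zero-divisor `x ∈ 𝔪` and each minimal prime `𝔓` of `R̂`, the complete local domain `R̂/𝔓`
has finite normalization (Thm. 1.102), whence an `N` with `x^N a ∈ s R̂ + 𝔓` whenever
`a/s ∈ R̄`; patching over the finitely many minimal primes of the reduced ring `R̂` and faithful
flatness of `R → R̂` give `x^{N'} R̄ ⊆ R`. [cite: Kollar2007, Thm. 1.101 and Thm. 1.102] -/
theorem module_finite_integralClosure_of_isReduced_adicCompletion' (hdim : ringKrullDim R = 1)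
    [IsReduced (AdicCompletion (maximalIdeal R) R)] (K : Type u) [CommRing K] [Algebra R K]
    [IsFractionRing R K] :
    Module.Finite R (integralClosure R K) := by
  classical
  haveI : IsReduced R := isReduced_of_isReduced_adicCompletion (A := R) inferInstance
  set S : Type u := AdicCompletion (maximalIdeal R) R with hS
  set W : Type u := ↥(integralClosure R K) with hW
  haveI : IsNoetherianRing S := isNoetherianRing_adicCompletion_maximalIdeal R
  haveI : Module.FaithfullyFlat R S := Module.FaithfullyFlat.of_flat_of_isLocalHom
  have hdimS : ringKrullDim S = 1 := (ringKrullDim_adicCompletion R).trans hdim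
  -- a non-zero-divisor in the maximal ideal
  obtain ⟨x, hxm, hx0⟩ := exists_mem_maximalIdeal_mem_nonZeroDivisors R hdim
  have hxS : algebraMap R S x ∈ maximalIdeal S := map_nonunit (algebraMap R S) x hxm
  -- non-zero-divisors of `R` stay outside the minimal primes of `S` (flatness)
  have hnotmin : ∀ r : R, r ∈ R⁰ → ∀ p ∈ minimalPrimes S, algebraMap R S r ∉ p := by
    intro r hr p hp hmem
    have h1 : IsSMulRegular S (algebraMap R S r) :=
      ((isRegular_iff_mem_nonZeroDivisors.mpr hr).left.isSMulRegular).of_flat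
    have hL : IsLeftRegular (algebraMap R S r) := isLeftRegular_iff.mpr h1
    have hR : IsRegular (algebraMap R S r) := ⟨hL, hL.right_of_commute fun b => Commute.all _ _⟩
    exact notMem_nonZeroDivisors_of_mem_mem_minimalPrimes hmem hp hR.mem_nonZeroDivisors
  have hfinmin : (minimalPrimes S).Finite := minimalPrimes.finite_of_isNoetherianRing S
  -- per minimal prime: a conductor exponent
  have hloc : ∀ p ∈ minimalPrimes S, ∃ N : ℕ, ∀ (a s : R) (n : ℕ) (c : ℕ → R), s ∈ R⁰ →
      a ^ n + ∑ i ∈ Finset.range n, c i * a ^ i * s ^ (n - i) = 0 →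
        algebraMap R S (x ^ N * a) ∈ Ideal.span {algebraMap R S s} ⊔ p := by
    intro p hp
    haveI hpprime : p.IsPrime := IsMinimalPrime.isPrime hp
    haveI : Nontrivial (S ⧸ p) := Ideal.Quotient.nontrivial_iff.mpr hpprime.ne_top
    haveI : IsLocalRing (S ⧸ p) :=
      IsLocalRing.of_surjective' (Ideal.Quotient.mk p) Ideal.Quotient.mk_surjective
    haveI : IsLocalHom (Ideal.Quotient.mk p) :=
      IsLocalHom.of_surjective _ Ideal.Quotient.mk_surjective
    haveI : IsAdicComplete (maximalIdeal (S ⧸ p)) (S ⧸ p) := by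
      have h := isAdicComplete_map_of_finite S (S ⧸ p) (maximalIdeal S)
      rwa [Ideal.Quotient.algebraMap_eq, ← maximalIdeal_quotient_eq_map] at h
    -- the image of `x` is a nonzero element of the maximal ideal, so `dim S/p = 1`
    set y : S ⧸ p := Ideal.Quotient.mk p (algebraMap R S x) with hy
    have hym : y ∈ maximalIdeal (S ⧸ p) := map_nonunit (Ideal.Quotient.mk p) _ hxS
    have hy0 : y ≠ 0 := by
      rw [hy, Ne, Ideal.Quotient.eq_zero_iff_mem]
      exact hnotmin x hx0 p hp
    have hdimD : ringKrullDim (S ⧸ p) = 1 := by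
      refine le_antisymm ((ringKrullDim_quotient_le p).trans hdimS.le) ?_
      have hnot : ¬ ringKrullDim (S ⧸ p) ≤ 0 := fun h0 => by
        haveI : Ring.KrullDimLE 0 (S ⧸ p) := Ring.krullDimLE_iff.mpr h0
        have hF : IsField (S ⧸ p) := Ring.KrullDimLE.isField_of_isDomain
        rw [IsLocalRing.isField_iff_maximalIdeal_eq] at hF
        rw [hF, Ideal.mem_bot] at hym
        exact hy0 hym
      exact Order.succ_le_of_lt (lt_of_not_ge hnot)
    obtain ⟨N, hN⟩ := exists_pow_mul_mem_range_of_complete (S ⧸ p) hdimD hym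
    refine ⟨N, fun a s n c hs hrel => ?_⟩
    set π : R →+* S ⧸ p := (Ideal.Quotient.mk p).comp (algebraMap R S) with hπ
    have hrelD : π a ^ n + ∑ i ∈ Finset.range n, π (c i) * π a ^ i * π s ^ (n - i) = 0 := by
      have := congrArg π hrel
      simpa only [map_add, map_pow, map_sum, map_mul, map_zero] using this
    have hsD : π s ≠ 0 := by
      rw [hπ, RingHom.comp_apply, Ne, Ideal.Quotient.eq_zero_iff_mem]
      exact hnotmin s hs p hp
    set L := FractionRing (S ⧸ p)
    have hsK : algebraMap (S ⧸ p) L (π s) ≠ 0 :=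
      (map_ne_zero_iff _ (IsFractionRing.injective (S ⧸ p) L)).mpr hsD
    have hint : IsIntegral (S ⧸ p) (algebraMap (S ⧸ p) L (π a) / algebraMap (S ⧸ p) L (π s)) :=
      isIntegral_div_of_homogeneous_rel hsK hrelD
    obtain ⟨d, hd⟩ := hN ⟨_, hint⟩
    -- clear denominators: `y^N · π a = d · π s`
    have hD : y ^ N * π a = d * π s := by
      apply IsFractionRing.injective (S ⧸ p) L
      have h1 : algebraMap (S ⧸ p) L (y ^ N) *
          (algebraMap (S ⧸ p) L (π a) / algebraMap (S ⧸ p) L (π s)) =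
          algebraMap (S ⧸ p) L d := by
        have := congrArg Subtype.val hd
        simpa using this
      rw [map_mul, map_mul, ← h1, mul_assoc, div_mul_cancel₀ _ hsK]
    obtain ⟨d', rfl⟩ := Ideal.Quotient.mk_surjective d
    have hmem : algebraMap R S (x ^ N * a) - d' * algebraMap R S s ∈ p := by
      rw [← Ideal.Quotient.eq]
      simpa only [hy, hπ, RingHom.comp_apply, map_mul, map_pow] using hD
    refine Submodule.mem_sup.mpr ⟨d' * algebraMap R S s,
      Ideal.mul_mem_left _ _ (Ideal.mem_span_singleton_self _), _, hmem, ?_⟩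
    ring
  choose! Nf hNf using hloc
  set N₀ : ℕ := hfinmin.toFinset.sup Nf with hN₀
  -- patching element and its power of `x`
  obtain ⟨e, he_notMem, he⟩ := exists_notMem_minimalPrimes_forall_mul_mem S hfinmin
  obtain ⟨M, hM⟩ := exists_pow_mem_span_of_notMem_minimalPrimes S hdimS.le he_notMem hxS
  obtain ⟨u, hu⟩ := Ideal.mem_span_singleton'.mp hM
  -- the structure map `R → Frac R` is injective; non-zero-divisors become units
  have hinjK : Function.Injective (algebraMap R K) :=
    IsFractionRing.injective R K
  have hinjW : Function.Injective (algebraMap R W) := fun a b h => by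
    have := congrArg (fun z : W => (z : K)) h
    exact hinjK this
  have hunitK : ∀ s : R, s ∈ R⁰ → IsUnit (algebraMap R K s) := fun s hs =>
    IsLocalization.map_units K ⟨s, hs⟩
  -- `x^(M+N₀) · R̄ ⊆ R`
  have key : ∀ w : W, ∃ t : R, algebraMap R W (x ^ (M + N₀)) * w = algebraMap R W t := by
    intro w
    obtain ⟨⟨a, s⟩, hws⟩ := IsLocalization.surj R⁰ (w : K)
    have hs0 : (s : R) ∈ R⁰ := s.2
    have hws' : (w : K) * algebraMap R K s =
        algebraMap R K a := hws
    obtain ⟨n, c, hrel⟩ := exists_homogeneous_rel_of_isIntegral (K := K)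
      hinjK w.2 (a := a) (s := (s : R)) hws'
    have hall : ∀ p ∈ minimalPrimes S,
        algebraMap R S (x ^ N₀ * a) ∈ Ideal.span {algebraMap R S s} ⊔ p := by
      intro p hp
      have h1 := hNf p hp a s n c hs0 hrel
      have hle : Nf p ≤ N₀ := Finset.le_sup (f := Nf) (hfinmin.mem_toFinset.mpr hp)
      have hxa : x ^ N₀ * a = x ^ (N₀ - Nf p) * (x ^ Nf p * a) := by
        rw [← mul_assoc, ← pow_add, Nat.sub_add_cancel hle]
      rw [hxa, map_mul]
      exact Ideal.mul_mem_left _ _ h1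
    have h2 : e * algebraMap R S (x ^ N₀ * a) ∈ Ideal.span {algebraMap R S (s : R)} :=
      he _ _ hall
    have h3 : algebraMap R S (x ^ (M + N₀) * a) ∈ Ideal.span {algebraMap R S (s : R)} := by
      have : algebraMap R S (x ^ (M + N₀) * a) = u * (e * algebraMap R S (x ^ N₀ * a)) := by
        rw [pow_add, mul_assoc, map_mul, map_pow, ← hu]
        ring
      rw [this]
      exact Ideal.mul_mem_left _ _ h2
    -- faithfully flat descent
    have h4 : x ^ (M + N₀) * a ∈ Ideal.span ({(s : R)} : Set R) := by
      rw [← Ideal.comap_map_eq_self_of_faithfullyFlat (B := S) (Ideal.span ({(s : R)} : Set R)),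
        Ideal.mem_comap, Ideal.map_span, Set.image_singleton]
      exact h3
    obtain ⟨t, ht⟩ := Ideal.mem_span_singleton'.mp h4
    refine ⟨t, ?_⟩
    -- compare in `Frac R`, where `s` is a unit
    apply Subtype.ext
    apply (hunitK s hs0).mul_left_injective
    change ((algebraMap R W (x ^ (M + N₀)) * w : W) : K) *
        algebraMap R K s =
      ((algebraMap R W t : W) : K) * algebraMap R K s
    have e1 : ((algebraMap R W (x ^ (M + N₀)) * w : W) : K) =
        algebraMap R K (x ^ (M + N₀)) * (w : K) := rfl
    have e2 : ((algebraMap R W t : W) : K) = algebraMap R K t := rfl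
    rw [e1, e2, mul_assoc, hws', ← map_mul, ← map_mul, ← ht]
  -- conclude: `R̄ ≅ x^k R̄ ⊆ R·1`, a Noetherian `R`-module
  have hxunit : IsUnit (algebraMap R K (x ^ (M + N₀))) :=
    hunitK _ (pow_mem hx0 _)
  set ψ : W →ₗ[R] W := LinearMap.mulLeft R (algebraMap R W (x ^ (M + N₀))) with hψ
  have hψinj : Function.Injective ψ := by
    intro w₁ w₂ h
    apply Subtype.ext
    apply hxunit.mul_right_injective
    exact congrArg Subtype.val h
  have hrange : LinearMap.range ψ ≤ LinearMap.range (Algebra.linearMap R W) := by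
    rintro _ ⟨w, rfl⟩
    obtain ⟨t, ht⟩ := key w
    exact ⟨t, ht.symm⟩
  haveI : IsNoetherian R (LinearMap.range (Algebra.linearMap R W)) :=
    isNoetherian_of_surjective (Algebra.linearMap R W).rangeRestrict
      (LinearMap.range_rangeRestrict _)
  haveI : IsNoetherian R (LinearMap.range ψ) := isNoetherian_of_le hrange
  haveI : Module.Finite R (LinearMap.range ψ) := Module.IsNoetherian.finite R _
  exact Module.Finite.equiv (LinearEquiv.ofInjective ψ hψinj).symm

end Reduced

end Literature.AlgebraicGeometry.Resolution

end
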